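import Mathlib
import Summits.NavierStokesRegularity.NavierStokesRegularity.Theses.TaoLadderRungTwoBreak
import Summits.NavierStokesRegularity.NavierStokesRegularity.Theorems.WakeRatchetEternalInviscidRateRetentionCostsAction
import HarnessLib

/-!
# THE UNITARY GAP of K2(1) `TaoLadderRungTwoBreak.BlowupRigidityOne` (stmt-NavierStokesRegularity-20206) IS CLOSED
  BY THE TREE: every non-trivial admissible DSS wave of a cancelling table is STRICTLY sub-unitary, so the upper
  clause `μ < 1` of `Surviving` is automatic, the «unitary transfer» of `…UnitaryGap` holds UNCONDITIONALLY, and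
  the crux / the classification stub are equivalent BY NAME to their lower-clause-only forms

MODEL lattice ODEs only (Tao 2016 §4 (4.8) in the self-similar log-time variables of §6.4; cell vocabulary
`IsDSSWave` / `Surviving` / `dssMu` / `IsEternal` / `EternalSurvivingFwd`); nothing in this file is a statement
about the Navier–Stokes equations, and NO item is closed by it (`--supports stmt-NavierStokesRegularity-20206`).
DEF-FREE; general `m` and general finite profile index `ρ` except in the stub- and route-shaped corollaries.

The 8th hand's helper `TaoLadderRungTwoBreakBlowupRigidityOneUnitaryGap` (p830389) isolated a «typed gap» of the
classification stub `stub_eternalIsDSS` (skeleton `9d85f4d387c689cd`): its hypothesis is fed by every admissible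
DSS wave with `μ ≥ (1+ε₀)⁻¹` (unitary `μ = 1` and super-unitary `μ > 1` included) while its conclusion demands
`μ < 1`, and it recorded the status of unitary / super-unitary waves as «OPEN (none is known)».  It is NOT open:
the WakeRatchet programme landed, for every cancelling table and every `ε₀ > 0`, the QUANTITATIVE
sub-unitarity `dssMu ε₀ T ≤ 1 − exp(−2C_AΛ⁻¹∫Σ_r‖Φ_r‖)` of every non-trivial admissible DSS wave
(`WakeRatchetDSS.dssWave_dssMu_le_leak`, module `…WakeRatchetEternalInviscidRateRetentionCostsAction`; the
leak ratchet: the Cauchy–Schwarz flux bound against the shell's own action makes every passed shell keep the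
fraction `≥ e^{−2C_AΛ⁻¹A}` of the tail).  This file imports it into the K2(1) bookkeeping:

* `dssMu_lt_one_of_dssWave` — general `m`: a non-trivial admissible DSS wave of a cancelling table at `ε₀ > 0`
  has `dssMu ε₀ T < 1`; `not_one_le_dssMu_of_dssWave` — NO unitary or super-unitary admissible wave exists, on
  any cancelling table, at any `ε₀ > 0` (the would-be refuter «robust blow-up driven only by waves with μ ≥ 1» of
  the item's docstring is void: such waves do not exist);
* `surviving_iff_inv_le_of_dssWave` — for a non-trivial admissible wave, `Surviving a ε₀ T ↔ (1+ε₀)^{-a} ≤ μ`;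
* `unitaryTransfer` — the conclusion of p830389's `unitaryTransfer_of_stub_eternalIsDSS`, now WITHOUT the stub
  and with an arbitrary threshold: every non-trivial admissible wave with `(1+ε₀)⁻¹ ≤ μ` is itself (S₁)-surviving;
* `exists_survivingDSSWave_iff_lower` — per table: «∃ non-trivial (S_a)-surviving admissible wave» ↔ «∃ non-trivial
  admissible wave with `(1+ε₀)^{-a} ≤ μ`»;
* `blowupRigidityOne_iff_lower`, `stubEternalIsDSS_iff_lower` — BY NAME: the route decl `BlowupRigidityOne` and
  the REGISTERED signature of `stub_eternalIsDSS` (verbatim) are equivalent to the same statements with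
  `Surviving 1 ε₀ T` replaced by the lower clause `(1+ε₀)^{-1} ≤ dssMu ε₀ T` alone.

HONEST LABEL: bookkeeping — one tree theorem of another route cited by name on this item; it removes the
`μ < 1` half of the classification stub's burden (what remains is the LOWER clause: a surviving eternal solution
must come with a wave of ratio `≥ (1+ε₀)⁻¹`, i.e. not slower than the dissipation index) and voids one typed risk
of the item; no stub, crux or summit is proved; rung 0.
-/

noncomputable section

-- the summit and its single sub-problem share the name (CONVENTIONS §1)
set_option linter.dupNamespace false

open Set Filter Topology MeasureTheory

namespace Summit.NavierStokesRegularity.NavierStokesRegularity.Theorems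

namespace BlowupRigidityOne

open Literature.Analysis.FluidPDE Literature.Analysis.FluidPDE.TaoCascade

variable {m : ℕ} {ρ : Type*} [Fintype ρ]

/-- **Strict sub-unitarity of admissible DSS waves (general `m`).** On a cancelling table at `ε₀ > 0`, an
admissible DSS wave with a non-zero profile value has per-shell energy ratio `dssMu ε₀ T < 1`: the tree's
quantitative bound `dssMu ≤ 1 − exp(−2C_AΛ⁻¹∫Σ_r‖Φ_r‖)` (`WakeRatchetDSS.dssWave_dssMu_le_leak`) and `exp > 0`.
[cite: Tao2016AveragedNS, §4 Lemma 4.1 (4.8)–(4.10) with the cancellation (4.3), §6.4; cell vocabulary (`IsDSSWave`, `dssMu`)] -/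
theorem dssMu_lt_one_of_dssWave {ε₀ : ℝ} (hε : 0 < ε₀)
    {α : Fin m → Fin m → Fin m → ℤ × ℤ × ℤ → ℝ} (hc : IsCancellingCoeff α)
    {π : Equiv.Perm ρ} {T : ℝ} {Φ : ρ → ℝ → Em m} (hW : IsDSSWave ε₀ α π T Φ)
    {r : ρ} {x : ℝ} (hne : Φ r x ≠ 0) : dssMu ε₀ T < 1 := by
  have h := WakeRatchetDSS.dssWave_dssMu_le_leak hε hc hW hne
  have hpos : 0 < Real.exp (-(2 * fluxConst α * (bigLam ε₀)⁻¹ * ∫ σ, sMass Φ σ)) := Real.exp_pos _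
  linarith

/-- **No unitary and no super-unitary admissible DSS wave**, on any cancelling table, at any `ε₀ > 0`: a wave
with `1 ≤ dssMu ε₀ T` is identically zero.
[cite: Tao2016AveragedNS, §4 Lemma 4.1 (4.8)–(4.10) with (4.3), §6.4; cell vocabulary (`IsDSSWave`, `dssMu`)] -/
theorem not_one_le_dssMu_of_dssWave {ε₀ : ℝ} (hε : 0 < ε₀)
    {α : Fin m → Fin m → Fin m → ℤ × ℤ × ℤ → ℝ} (hc : IsCancellingCoeff α)
    {π : Equiv.Perm ρ} {T : ℝ} {Φ : ρ → ℝ → Em m} (hW : IsDSSWave ε₀ α π T Φ)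
    (hμ : 1 ≤ dssMu ε₀ T) : ∀ r x, Φ r x = 0 := by
  intro r x
  by_contra hne
  have h := dssMu_lt_one_of_dssWave hε hc hW hne
  linarith

/-- **Survival is its lower clause.** For a non-trivial admissible DSS wave of a cancelling table at `ε₀ > 0`,
`Surviving a ε₀ T ↔ (1+ε₀)^{-a} ≤ dssMu ε₀ T` (the upper clause `dssMu < 1` holds automatically).
[cite: Tao2016AveragedNS, §4 Lemma 4.1 (4.8), the viscous equation before Thm. 4.2, §6.4; cell vocabulary (`Surviving`, `dssMu`)] -/
theorem surviving_iff_inv_le_of_dssWave {ε₀ a : ℝ} (hε : 0 < ε₀)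
    {α : Fin m → Fin m → Fin m → ℤ × ℤ × ℤ → ℝ} (hc : IsCancellingCoeff α)
    {π : Equiv.Perm ρ} {T : ℝ} {Φ : ρ → ℝ → Em m} (hW : IsDSSWave ε₀ α π T Φ)
    {r : ρ} {x : ℝ} (hne : Φ r x ≠ 0) :
    Surviving a ε₀ T ↔ (1 + ε₀) ^ (-a) ≤ dssMu ε₀ T :=
  ⟨fun h => h.1, fun h => ⟨h, dssMu_lt_one_of_dssWave hε hc hW hne⟩⟩

/-- **Per table: a non-trivial (S_a)-surviving admissible wave exists iff a non-trivial admissible wave with the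
LOWER clause `(1+ε₀)^{-a} ≤ μ` exists** (same wave).
[cite: Tao2016AveragedNS, §4 Lemma 4.1 (4.8), §6.4; cell vocabulary (`IsDSSWave`, `Surviving`, `dssMu`)] -/
theorem exists_survivingDSSWave_iff_lower {ε₀ a : ℝ} (hε : 0 < ε₀)
    {α : Fin m → Fin m → Fin m → ℤ × ℤ × ℤ → ℝ} (hc : IsCancellingCoeff α) :
    (∃ (q : ℕ) (π : Equiv.Perm (Fin q)) (T : ℝ) (Φ : Fin q → ℝ → Em m),
        IsDSSWave ε₀ α π T Φ ∧ Surviving a ε₀ T ∧ ∃ r x, Φ r x ≠ 0) ↔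
      (∃ (q : ℕ) (π : Equiv.Perm (Fin q)) (T : ℝ) (Φ : Fin q → ℝ → Em m),
        IsDSSWave ε₀ α π T Φ ∧ (1 + ε₀) ^ (-a) ≤ dssMu ε₀ T ∧ ∃ r x, Φ r x ≠ 0) := by
  constructor
  · rintro ⟨q, π, T, Φ, hW, hS, r, x, hne⟩
    exact ⟨q, π, T, Φ, hW, hS.1, r, x, hne⟩
  · rintro ⟨q, π, T, Φ, hW, hμ, r, x, hne⟩
    exact ⟨q, π, T, Φ, hW, (surviving_iff_inv_le_of_dssWave hε hc hW hne).2 hμ, r, x, hne⟩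

/-- **The «unitary-to-sub-unitary transfer» holds unconditionally** (it was derived in `…UnitaryGap` from the
classification stub): for EVERY threshold `εs > 0`, every `ε₀ ∈ (0, εs]`, every table of `E₂(R)` and every
non-trivial admissible DSS wave with `(1+ε₀)⁻¹ ≤ μ`, that same wave is (S₁)-surviving. No stub is used; the
transfer carries no content beyond strict sub-unitarity.
[cite: Tao2016AveragedNS, §4 Lemma 4.1 (4.8), §6.4; cell vocabulary (`IsDSSWave`, `Surviving`, `dssMu`, `InTableClass`)] -/
theorem unitaryTransfer {εs : ℝ} (hεs : 0 < εs) :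
    ∀ R : ℝ, 1 ≤ R → ∃ εs' : ℝ, 0 < εs' ∧ ∀ ε₀ : ℝ, 0 < ε₀ → ε₀ ≤ εs' →
      ∀ α : (Fin 4 → Fin 4 → Fin 4 → ℤ × ℤ × ℤ → ℝ), InTableClass R α →
        (∃ (q : ℕ) (π : Equiv.Perm (Fin q)) (T : ℝ) (Φ : Fin q → ℝ → Em 4),
          IsDSSWave ε₀ α π T Φ ∧ (1 + ε₀) ^ (-(1 : ℝ)) ≤ dssMu ε₀ T ∧ ∃ r x, Φ r x ≠ 0) →
        ∃ (q : ℕ) (π : Equiv.Perm (Fin q)) (T : ℝ) (Φ : Fin q → ℝ → Em 4),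
          IsDSSWave ε₀ α π T Φ ∧ Surviving 1 ε₀ T ∧ ∃ r x, Φ r x ≠ 0 :=
  fun _R _hR => ⟨εs, hεs, fun _ε₀ hε₀ _hle _α hα hwave =>
    (exists_survivingDSSWave_iff_lower hε₀ hα.2.1).2 hwave⟩

/-- **BY NAME: the crux K2(1) is its lower-clause form.** The route decl `BlowupRigidityOne` is equivalent to
the same statement with `Surviving 1 ε₀ T` replaced by `(1+ε₀)^{-1} ≤ dssMu ε₀ T`: robust blow-up must produce
a non-trivial admissible wave NOT SLOWER than the dissipation index — sub-unitarity of that wave is free.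
[cite: Tao2016AveragedNS, §4 Thm. 4.2 (statement shape), Lemma 4.1 (4.8), §6.4; cell vocabulary (`NoGlobalCascade`, `IsDSSWave`, `Surviving`)] -/
theorem blowupRigidityOne_iff_lower :
    Summit.NavierStokesRegularity.NavierStokesRegularity.Theses.TaoLadderRungTwoBreak.BlowupRigidityOne ↔
      ∀ R : ℝ, 1 ≤ R → ∃ εs : ℝ, 0 < εs ∧ ∀ ε₀ : ℝ, 0 < ε₀ → ε₀ ≤ εs →
        ∀ (α : Fin 4 → Fin 4 → Fin 4 → ℤ × ℤ × ℤ → ℝ) (X₀ : Fin 4 → ℝ), InTableClass R α →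
          NoGlobalCascade ε₀ α X₀ →
          ∃ (q : ℕ) (π : Equiv.Perm (Fin q)) (T : ℝ) (Φ : Fin q → ℝ → Em 4),
            IsDSSWave ε₀ α π T Φ ∧ (1 + ε₀) ^ (-(1 : ℝ)) ≤ dssMu ε₀ T ∧ ∃ r x, Φ r x ≠ 0 := by
  unfold Summit.NavierStokesRegularity.NavierStokesRegularity.Theses.TaoLadderRungTwoBreak.BlowupRigidityOne
  constructor
  · intro h R hR
    obtain ⟨εs, hεs, H⟩ := h R hR
    refine ⟨εs, hεs, fun ε₀ hε₀ hle α X₀ hα hN => ?_⟩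
    exact (exists_survivingDSSWave_iff_lower hε₀ hα.2.1).1 (H ε₀ hε₀ hle α X₀ hα hN)
  · intro h R hR
    obtain ⟨εs, hεs, H⟩ := h R hR
    refine ⟨εs, hεs, fun ε₀ hε₀ hle α X₀ hα hN => ?_⟩
    exact (exists_survivingDSSWave_iff_lower hε₀ hα.2.1).2 (H ε₀ hε₀ hle α X₀ hα hN)

/-- **BY TEXT: the classification stub is its lower-clause form.** The REGISTERED signature of
`stub_eternalIsDSS` (skeleton `9d85f4d387c689cd`, verbatim on the left) is equivalent to the same statement
with `Surviving 1 ε₀ T` replaced by `(1+ε₀)^{-1} ≤ dssMu ε₀ T`: what the stub must deliver from a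
forward-(S₁)-surviving admissible eternal solution is a non-trivial admissible DSS wave whose ratio is at least
the dissipation index; the «typed gap μ < 1 vs μ ≤ 1» of `…UnitaryGap` is not a gap.
[cite: Tao2016AveragedNS, §4 Lemma 4.1 (4.8), §6.4; cell vocabulary (`IsEternal`, `EternalSurvivingFwd`, `IsDSSWave`, `Surviving`)] -/
theorem stubEternalIsDSS_iff_lower :
    (∀ R : ℝ, 1 ≤ R → ∃ εs : ℝ, 0 < εs ∧ ∀ ε₀ : ℝ, 0 < ε₀ → ε₀ ≤ εs →
      ∀ α : (Fin 4 → Fin 4 → Fin 4 → ℤ × ℤ × ℤ → ℝ),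
        Literature.Analysis.FluidPDE.TaoCascade.InTableClass R α →
        (∃ W : ℤ → ℝ → Literature.Analysis.FluidPDE.TaoCascade.Em 4,
          Literature.Analysis.FluidPDE.TaoCascade.IsEternal ε₀ α W ∧
          Literature.Analysis.FluidPDE.TaoCascade.EternalSurvivingFwd 1 ε₀ W) →
        ∃ (q : ℕ) (π : Equiv.Perm (Fin q)) (T : ℝ)
          (Φ : Fin q → ℝ → Literature.Analysis.FluidPDE.TaoCascade.Em 4),
          Literature.Analysis.FluidPDE.TaoCascade.IsDSSWave ε₀ α π T Φ ∧
          Literature.Analysis.FluidPDE.TaoCascade.Surviving 1 ε₀ T ∧ ∃ r x, Φ r x ≠ 0) ↔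
    (∀ R : ℝ, 1 ≤ R → ∃ εs : ℝ, 0 < εs ∧ ∀ ε₀ : ℝ, 0 < ε₀ → ε₀ ≤ εs →
      ∀ α : (Fin 4 → Fin 4 → Fin 4 → ℤ × ℤ × ℤ → ℝ), InTableClass R α →
        (∃ W : ℤ → ℝ → Em 4, IsEternal ε₀ α W ∧ EternalSurvivingFwd 1 ε₀ W) →
        ∃ (q : ℕ) (π : Equiv.Perm (Fin q)) (T : ℝ) (Φ : Fin q → ℝ → Em 4),
          IsDSSWave ε₀ α π T Φ ∧ (1 + ε₀) ^ (-(1 : ℝ)) ≤ dssMu ε₀ T ∧ ∃ r x, Φ r x ≠ 0) := by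
  constructor
  · intro h R hR
    obtain ⟨εs, hεs, H⟩ := h R hR
    refine ⟨εs, hεs, fun ε₀ hε₀ hle α hα hW => ?_⟩
    exact (exists_survivingDSSWave_iff_lower hε₀ hα.2.1).1 (H ε₀ hε₀ hle α hα hW)
  · intro h R hR
    obtain ⟨εs, hεs, H⟩ := h R hR
    refine ⟨εs, hεs, fun ε₀ hε₀ hle α hα hW => ?_⟩
    exact (exists_survivingDSSWave_iff_lower hε₀ hα.2.1).2 (H ε₀ hε₀ hle α hα hW)

/-! ### Appendix (same hand): the `a = 5` rung of K1/K2 is the SURVIVAL-FREE rung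

With strict sub-unitarity free, the tree's `IsDSSWave.surviving_five` (which assumed `dssMu < 1`) says that EVERY
non-trivial admissible DSS wave of a cancelling table at `ε₀ > 0` is (S₅)-surviving; hence the `a = 5` members of
theory-2's families `NoSurvivingDSS R a` / `BlowupRigidity R a` carry NO survival clause at all: K1(5) = «below a
threshold no E₂(R) table carries a non-trivial admissible DSS wave», K2(5) = «below a threshold robust blow-up of
an E₂(R) table forces SOME non-trivial admissible DSS wave» — the ratio-free core «robust blow-up is asymptotically
self-similar»; K2(1) = K2(5) + speed selection `μ ≥ (1+ε₀)⁻¹` (`BlowupRigidity.mono`). -/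

/-- **Every non-trivial admissible DSS wave is (S₅)-surviving** (cancelling table, `ε₀ > 0`; no ratio hypothesis):
`(1+ε₀)^{-5} ≤ μ` is the delay kinematics `T > 0`, `μ < 1` is strict sub-unitarity.
[cite: Tao2016AveragedNS, §4 Lemma 4.1 (4.8), §6.4; cell vocabulary (`IsDSSWave`, `Surviving`)] -/
theorem surviving_five_of_dssWave {ε₀ : ℝ} (hε : 0 < ε₀)
    {α : Fin m → Fin m → Fin m → ℤ × ℤ × ℤ → ℝ} (hc : IsCancellingCoeff α)
    {π : Equiv.Perm ρ} {T : ℝ} {Φ : ρ → ℝ → Em m} (hW : IsDSSWave ε₀ α π T Φ)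
    {r : ρ} {x : ℝ} (hne : Φ r x ≠ 0) : Surviving 5 ε₀ T :=
  hW.surviving_five hε (dssMu_lt_one_of_dssWave hε hc hW hne)

/-- Hence (S_a)-surviving for every `a ≥ 5`. [cite: Tao2016AveragedNS, §4, §6.4; cell vocabulary (`Surviving`)] -/
theorem surviving_of_five_le_of_dssWave {ε₀ a : ℝ} (hε : 0 < ε₀) (ha : 5 ≤ a)
    {α : Fin m → Fin m → Fin m → ℤ × ℤ × ℤ → ℝ} (hc : IsCancellingCoeff α)
    {π : Equiv.Perm ρ} {T : ℝ} {Φ : ρ → ℝ → Em m} (hW : IsDSSWave ε₀ α π T Φ)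
    {r : ρ} {x : ℝ} (hne : Φ r x ≠ 0) : Surviving a ε₀ T :=
  (surviving_five_of_dssWave hε hc hW hne).mono hε.le ha

/-- **K1(5) is the wave-free statement**: `NoSurvivingDSS R 5` holds iff below a threshold no E₂(R) table carries
a non-trivial admissible DSS wave (any period, shape permutation, delay).
[cite: Tao2016AveragedNS, §4 Thm. 4.2 (statement shape), §6.4; cell vocabulary (`NoSurvivingDSS`, `IsDSSWave`)] -/
theorem noSurvivingDSS_five_iff_noWave {R : ℝ} :
    NoSurvivingDSS R 5 ↔
      ∃ εs : ℝ, 0 < εs ∧ ∀ ε₀ : ℝ, 0 < ε₀ → ε₀ ≤ εs →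
        ∀ α : Fin 4 → Fin 4 → Fin 4 → ℤ × ℤ × ℤ → ℝ, InTableClass R α →
          ∀ (q : ℕ) (π : Equiv.Perm (Fin q)) (T : ℝ) (Φ : Fin q → ℝ → Em 4),
            IsDSSWave ε₀ α π T Φ → ∀ r x, Φ r x = 0 := by
  constructor
  · rintro ⟨εs, hεs, H⟩
    refine ⟨εs, hεs, fun ε₀ hε₀ hle α hα q π T Φ hW r x => ?_⟩
    by_contra hne
    exact hne (H ε₀ hε₀ hle α hα q π T Φ hW (surviving_five_of_dssWave hε₀ hα.2.1 hW hne) r x)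
  · rintro ⟨εs, hεs, H⟩
    exact ⟨εs, hεs, fun ε₀ hε₀ hle α hα q π T Φ hW _ r x => H ε₀ hε₀ hle α hα q π T Φ hW r x⟩

/-- **K2(5) is wave existence**: `BlowupRigidity R 5` holds iff below a threshold robust blow-up
(`NoGlobalCascade`) of an E₂(R) table from a one-shell datum forces the table to carry SOME non-trivial
admissible DSS wave — the survival-free core «robust blow-up is asymptotically (discretely) self-similar».
[cite: Tao2016AveragedNS, §4 Thm. 4.2 (statement shape), §6.4; cell vocabulary (`BlowupRigidity`, `NoGlobalCascade`, `IsDSSWave`)] -/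
theorem blowupRigidity_five_iff_waveExistence {R : ℝ} :
    BlowupRigidity R 5 ↔
      ∃ εs : ℝ, 0 < εs ∧ ∀ ε₀ : ℝ, 0 < ε₀ → ε₀ ≤ εs →
        ∀ (α : Fin 4 → Fin 4 → Fin 4 → ℤ × ℤ × ℤ → ℝ) (X₀ : Fin 4 → ℝ), InTableClass R α →
          NoGlobalCascade ε₀ α X₀ →
            ∃ (q : ℕ) (π : Equiv.Perm (Fin q)) (T : ℝ) (Φ : Fin q → ℝ → Em 4),
              IsDSSWave ε₀ α π T Φ ∧ ∃ r x, Φ r x ≠ 0 := by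
  constructor
  · rintro ⟨εs, hεs, H⟩
    refine ⟨εs, hεs, fun ε₀ hε₀ hle α X₀ hα hN => ?_⟩
    obtain ⟨q, π, T, Φ, hW, -, r, x, hne⟩ := H ε₀ hε₀ hle α X₀ hα hN
    exact ⟨q, π, T, Φ, hW, r, x, hne⟩
  · rintro ⟨εs, hεs, H⟩
    refine ⟨εs, hεs, fun ε₀ hε₀ hle α X₀ hα hN => ?_⟩
    obtain ⟨q, π, T, Φ, hW, r, x, hne⟩ := H ε₀ hε₀ hle α X₀ hα hN
    exact ⟨q, π, T, Φ, hW, surviving_five_of_dssWave hε₀ hα.2.1 hW hne, r, x, hne⟩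

/-- **BY NAME: K2(1) contains the survival-free core.** The route decl `BlowupRigidityOne` implies, for every
spread `R ≥ 1`, wave existence below a threshold (`= BlowupRigidity R 5`); what K2(1) adds to it is the SPEED
SELECTION `μ ≥ (1+ε₀)⁻¹` of `blowupRigidityOne_iff_lower`.
[cite: Tao2016AveragedNS, §4 Thm. 4.2 (statement shape), §6.4; cell vocabulary (`BlowupRigidity`)] -/
theorem blowupRigidity_five_of_blowupRigidityOne
    (h : Summit.NavierStokesRegularity.NavierStokesRegularity.Theses.TaoLadderRungTwoBreak.BlowupRigidityOne) :
    ∀ R : ℝ, 1 ≤ R → BlowupRigidity R 5 := by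
  intro R hR
  obtain ⟨εs, hεs, H⟩ := h R hR
  exact BlowupRigidity.mono ⟨εs, hεs, H⟩ (by norm_num)

end BlowupRigidityOne

end Summit.NavierStokesRegularity.NavierStokesRegularity.Theorems

end
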